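import Mathlib
import Summits.ValiantsHypothesis.ValiantsHypothesis.Theorems.NewtonUnitEquationsNewtonTauWeakCornerDefs
import Summits.ValiantsHypothesis.ValiantsHypothesis.Theorems.NewtonUnitEquationsNewtonTauWeakVdpDefs

/-!
# `NewtonTauWeak` (stmt-ValiantsHypothesis-5904), line `binomial-normal-form`: objects of the `K = 3` GLOBAL COUNT
# (bivariate Laurent polynomials and strict bottoms)

Route-posited objects (D-0016 `…Defs` file) for the sub-stub `fixedKCoincidence_t2_K3` of the open stub
`stub_binomialNewtonTauCommon` (KPTT arXiv:1308.2286 Conj. 1 at `t = 2`, `K = 3` products, exponent lists without short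
2-vs-1 relations; plan `Cruxes/NewtonTauWeak/Lines/binomial-normal-form-ltc.md`, lead c2, §2–§5).  The global-to-local
reduction of that plan (the FLIP identity `1 - ρ X^d = (-ρ X^d)(1 - ρ⁻¹ X^{-d})`, §2 of the card) is a genuine ring identity
only for LAURENT polynomials, so the local analysis is carried out in the group algebra `ℂ[ℤ²]`:

* `Laurent` — the ring `AddMonoidAlgebra ℂ (Fin 2 → ℤ)` of bivariate Laurent polynomials; `T z` its monomial `X^z`;
* `expZ : (Fin 2 →₀ ℕ) →+ (Fin 2 → ℤ)` — the exponent cast, and `toLaurent : ℂ[X,Y] →+* Laurent` the embedding it induces;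
* `IsBot ω F z` — `z` is THE strict `ω`-lightest exponent of `F` for a real weight `ω` (the weight `wt` is the one of the
  corner model, `…CornerDefs.lean`); for the embedding of a polynomial this is `IsTop (-ω)` of the line `euler-wronskian-vdp`
  (`…VdpDefs.lean`), see `isBot_toLaurent_iff`.

Everything here is a definition or routine API [folklore]; first users: the `K = 3` files
`Theorems/NewtonUnitEquationsNewtonTauWeakK3*.lean`.
-/

-- the namespace mandated for this Theorems file repeats the component `ValiantsHypothesis`
set_option linter.dupNamespace false

noncomputable section

open scoped BigOperators
open Summit.ValiantsHypothesis.ValiantsHypothesis.Theorems.NewtonTauWeakCorner (wt wt_add)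
open Summit.ValiantsHypothesis.ValiantsHypothesis.Theorems.NewtonTauWeakVdp (wdeg IsGeneric IsTop)

namespace Summit.ValiantsHypothesis.ValiantsHypothesis.Theorems.NewtonTauWeakK3

/-! ## Definitions -/

/-- The ring of bivariate Laurent polynomials over `ℂ`: the group algebra of `ℤ²`. [folklore] -/
abbrev Laurent : Type := AddMonoidAlgebra ℂ (Fin 2 → ℤ)

/-- The Laurent monomial `X^z`, `z ∈ ℤ²`. [folklore] -/
def T (z : Fin 2 → ℤ) : Laurent := AddMonoidAlgebra.single z 1

/-- The exponent cast `ℕ² → ℤ²` as an additive monoid homomorphism. [folklore] -/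
def expZ : (Fin 2 →₀ ℕ) →+ (Fin 2 → ℤ) where
  toFun e i := (e i : ℤ)
  map_zero' := by funext i; simp
  map_add' a b := by funext i; simp

/-- The embedding of bivariate polynomials into bivariate Laurent polynomials. [folklore] -/
def toLaurent : MvPolynomial (Fin 2) ℂ →+* Laurent := AddMonoidAlgebra.mapDomainRingHom ℂ expZ

/-- `z` is THE strict `ω`-bottom exponent of the Laurent polynomial `F`: its coefficient is nonzero and every other
exponent with a nonzero coefficient is strictly heavier. [folklore] -/
def IsBot (ω : Fin 2 → ℝ) (F : Laurent) (z : Fin 2 → ℤ) : Prop :=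
  F.coeff z ≠ 0 ∧ ∀ z', F.coeff z' ≠ 0 → z' ≠ z → wt ω z < wt ω z'

/-! ## API: monomials -/

/-- `X^z X^{z'} = X^{z+z'}`. [folklore] -/
theorem T_mul_T (z z' : Fin 2 → ℤ) : T z * T z' = T (z + z') := by
  simp [T, AddMonoidAlgebra.single_mul_single]

/-- `X^0 = 1`. [folklore] -/
theorem T_zero : T 0 = 1 := rfl

/-- `X^z` is a unit. [folklore] -/
theorem isUnit_T (z : Fin 2 → ℤ) : IsUnit (T z) :=
  ⟨⟨T z, T (-z), by rw [T_mul_T, add_neg_cancel, T_zero], by rw [T_mul_T, neg_add_cancel, T_zero]⟩, rfl⟩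

/-- Powers of a monomial. [folklore] -/
theorem T_pow (z : Fin 2 → ℤ) (k : ℕ) : T z ^ k = T ((k : ℤ) • z) := by
  induction k with
  | zero => simp [T_zero]
  | succ k ih => rw [pow_succ, ih, T_mul_T]; congr 1; simp [add_smul]

/-- Coefficients of a monomial. [folklore] -/
theorem coeff_T (z h : Fin 2 → ℤ) : (T z).coeff h = if z = h then 1 else 0 := by
  simp [T, Finsupp.single_apply]

/-- Coefficients of a shifted Laurent polynomial: `[X^h](X^z F) = [X^{h-z}] F`. [folklore] -/
theorem coeff_T_mul (z h : Fin 2 → ℤ) (F : Laurent) : (T z * F).coeff h = F.coeff (h - z) := by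
  rw [T, AddMonoidAlgebra.coeff_single_mul_apply, one_mul, neg_add_eq_sub]

/-- Coefficients of a scalar multiple written with the constant `c • F`. [folklore] -/
theorem coeff_smul (c : ℂ) (F : Laurent) (h : Fin 2 → ℤ) : (c • F).coeff h = c * F.coeff h := by
  simp [AddMonoidAlgebra.coeff_smul]

/-! ## API: the embedding of polynomials -/

/-- The exponent cast in coordinates. [folklore] -/
@[simp] theorem expZ_apply (e : Fin 2 →₀ ℕ) (i : Fin 2) : expZ e i = (e i : ℤ) := rfl

/-- The exponent cast is injective. [folklore] -/
theorem expZ_injective : Function.Injective expZ := by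
  intro a b h
  ext i
  have := congr_fun h i
  simpa using this

/-- The embedding on monomials. [folklore] -/
theorem toLaurent_monomial (e : Fin 2 →₀ ℕ) (c : ℂ) :
    toLaurent (MvPolynomial.monomial e c) = c • T (expZ e) := by
  rw [toLaurent, AddMonoidAlgebra.mapDomainRingHom_apply, ← MvPolynomial.single_eq_monomial,
    AddMonoidAlgebra.mapDomain_single, T, AddMonoidAlgebra.smul_single, smul_eq_mul, mul_one]

/-- The embedding on constants. [folklore] -/
theorem toLaurent_C (c : ℂ) : toLaurent (MvPolynomial.C c) = c • (1 : Laurent) := by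
  rw [MvPolynomial.C_apply, toLaurent_monomial, map_zero, T_zero]

/-- Coefficients of the embedding at cast exponents. [folklore] -/
theorem coeff_toLaurent (p : MvPolynomial (Fin 2) ℂ) (e : Fin 2 →₀ ℕ) :
    (toLaurent p).coeff (expZ e) = p.coeff e := by
  rw [toLaurent, AddMonoidAlgebra.mapDomainRingHom_apply, AddMonoidAlgebra.mapDomain,
    AddMonoidAlgebra.coeff_ofCoeff, Finsupp.mapDomain_apply expZ_injective]
  rfl

/-- Coefficients of the embedding vanish off the cast exponents. [folklore] -/
theorem coeff_toLaurent_eq_zero (p : MvPolynomial (Fin 2) ℂ) (z : Fin 2 → ℤ) (hz : z ∉ Set.range expZ) :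
    (toLaurent p).coeff z = 0 := by
  rw [toLaurent, AddMonoidAlgebra.mapDomainRingHom_apply, AddMonoidAlgebra.mapDomain,
    AddMonoidAlgebra.coeff_ofCoeff, Finsupp.mapDomain_notin_range _ _ hz]

/-- The embedding is injective. [folklore] -/
theorem toLaurent_injective : Function.Injective toLaurent := by
  intro p q h
  ext e
  have := congrArg (fun F : Laurent => F.coeff (expZ e)) h
  simpa only [coeff_toLaurent] using this

/-- A nonzero coefficient of the embedding sits at a cast exponent. [folklore] -/
theorem exists_eq_expZ_of_coeff_toLaurent_ne_zero (p : MvPolynomial (Fin 2) ℂ) (z : Fin 2 → ℤ)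
    (hz : (toLaurent p).coeff z ≠ 0) : ∃ e, z = expZ e := by
  by_contra h
  push Not at h
  exact hz (coeff_toLaurent_eq_zero p z fun ⟨e, he⟩ => h e he.symm)

/-! ## API: weights -/

/-- The weight of a cast exponent is the weighted degree. [folklore] -/
theorem wt_expZ (ω : Fin 2 → ℝ) (e : Fin 2 →₀ ℕ) : wt ω (expZ e) = wdeg ω e := by
  simp [wt, wdeg]

/-- The weight is odd in the weight vector. [folklore] -/
theorem wt_neg_left (ω : Fin 2 → ℝ) (z : Fin 2 → ℤ) : wt (-ω) z = -wt ω z := by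
  simp [wt]; ring

/-- The weight of `-z`. [folklore] -/
theorem wt_neg (ω : Fin 2 → ℝ) (z : Fin 2 → ℤ) : wt ω (-z) = -wt ω z := by
  simp [wt]; ring

/-- The weight of a difference. [folklore] -/
theorem wt_sub (ω : Fin 2 → ℝ) (z z' : Fin 2 → ℤ) : wt ω (z - z') = wt ω z - wt ω z' := by
  simp [wt]; ring

/-- A generic weight (injective weighted degree on `ℕ²`) is injective on all of `ℤ²`. [folklore] -/
theorem wt_injective_of_isGeneric {w : Fin 2 → ℝ} (hw : IsGeneric w) : Function.Injective (wt w) := by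
  intro a b h
  -- shift both points into `ℕ²`
  obtain ⟨c, hca, hcb⟩ : ∃ c : Fin 2 → ℤ, (∀ i, 0 ≤ a i + c i) ∧ ∀ i, 0 ≤ b i + c i := by
    refine ⟨fun i => |a i| + |b i|, fun i => ?_, fun i => ?_⟩
    · show 0 ≤ a i + (|a i| + |b i|)
      have := neg_abs_le (a i); have := abs_nonneg (b i); linarith
    · show 0 ≤ b i + (|a i| + |b i|)
      have := neg_abs_le (b i); have := abs_nonneg (a i); linarith
  set ea : Fin 2 →₀ ℕ := Finsupp.equivFunOnFinite.symm fun i => (a i + c i).toNat with hea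
  set eb : Fin 2 →₀ ℕ := Finsupp.equivFunOnFinite.symm fun i => (b i + c i).toNat with heb
  have hza : expZ ea = a + c := by
    funext i; simp [hea, Int.toNat_of_nonneg (hca i)]
  have hzb : expZ eb = b + c := by
    funext i; simp [heb, Int.toNat_of_nonneg (hcb i)]
  have hwd : wdeg w ea = wdeg w eb := by
    rw [← wt_expZ, ← wt_expZ, hza, hzb, wt_add, wt_add, h]
  have := hw hwd
  have h2 : expZ ea = expZ eb := by rw [this]
  rw [hza, hzb] at h2
  exact add_right_cancel h2

/-- The negative of a generic weight is injective on `ℤ²`. [folklore] -/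
theorem wt_neg_injective_of_isGeneric {w : Fin 2 → ℝ} (hw : IsGeneric w) : Function.Injective (wt (-w)) := by
  intro a b h
  rw [wt_neg_left, wt_neg_left, neg_inj] at h
  exact wt_injective_of_isGeneric hw h

/-! ## API: strict bottoms -/

/-- The bottom exponent carries a nonzero coefficient. [folklore] -/
theorem IsBot.coeff_ne_zero {ω : Fin 2 → ℝ} {F : Laurent} {z : Fin 2 → ℤ} (h : IsBot ω F z) : F.coeff z ≠ 0 :=
  h.1

/-- A Laurent polynomial with a bottom is nonzero. [folklore] -/
theorem IsBot.ne_zero {ω : Fin 2 → ℝ} {F : Laurent} {z : Fin 2 → ℤ} (h : IsBot ω F z) : F ≠ 0 := by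
  rintro rfl
  exact h.1 (by simp)

/-- Every other exponent is weakly heavier than the bottom. [folklore] -/
theorem IsBot.le {ω : Fin 2 → ℝ} {F : Laurent} {z : Fin 2 → ℤ} (h : IsBot ω F z) (z' : Fin 2 → ℤ)
    (hz' : F.coeff z' ≠ 0) : wt ω z ≤ wt ω z' := by
  by_cases hzz : z' = z
  · rw [hzz]
  · exact (h.2 z' hz' hzz).le

/-- The bottom is unique. [folklore] -/
theorem IsBot.unique {ω : Fin 2 → ℝ} {F : Laurent} {z z' : Fin 2 → ℤ} (h : IsBot ω F z) (h' : IsBot ω F z') :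
    z = z' := by
  by_contra hne
  have h1 := h.2 z' h'.1 (Ne.symm hne)
  have h2 := h'.2 z h.1 hne
  linarith

/-- For a weight injective on `ℤ²`, every nonzero Laurent polynomial has a bottom. [folklore] -/
theorem exists_isBot {ω : Fin 2 → ℝ} (hω : Function.Injective (wt ω)) {F : Laurent} (hF : F ≠ 0) :
    ∃ z, IsBot ω F z := by
  have hne : F.coeff.support.Nonempty := by
    rw [Finsupp.support_nonempty_iff, Ne, AddMonoidAlgebra.coeff_eq_zero]
    exact hF
  obtain ⟨z, hz, hmin⟩ := F.coeff.support.exists_min_image (wt ω) hne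
  refine ⟨z, Finsupp.mem_support_iff.mp hz, fun z' hz' hne' => ?_⟩
  exact lt_of_le_of_ne (hmin z' (Finsupp.mem_support_iff.mpr hz')) fun heq => hne' (hω heq).symm

/-- A point with nonzero coefficient that is weakly lighter than every other nonzero point is the bottom (for a weight
injective on `ℤ²`). [folklore] -/
theorem isBot_of_le {ω : Fin 2 → ℝ} (hω : Function.Injective (wt ω)) {F : Laurent} {z : Fin 2 → ℤ}
    (hz : F.coeff z ≠ 0) (hle : ∀ z', F.coeff z' ≠ 0 → wt ω z ≤ wt ω z') : IsBot ω F z :=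
  ⟨hz, fun z' hz' hne => lt_of_le_of_ne (hle z' hz') fun heq => hne (hω heq).symm⟩

/-- Scaling by a nonzero constant does not move the bottom. [folklore] -/
theorem IsBot.smul {ω : Fin 2 → ℝ} {F : Laurent} {z : Fin 2 → ℤ} (h : IsBot ω F z) {c : ℂ} (hc : c ≠ 0) :
    IsBot ω (c • F) z := by
  refine ⟨by rw [coeff_smul]; exact mul_ne_zero hc h.1, fun z' hz' hne => h.2 z' ?_ hne⟩
  rw [coeff_smul] at hz'
  exact right_ne_zero_of_mul hz'

/-- Shifting by a monomial shifts the bottom. [folklore] -/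
theorem IsBot.T_mul {ω : Fin 2 → ℝ} {F : Laurent} {z : Fin 2 → ℤ} (h : IsBot ω F z) (p : Fin 2 → ℤ) :
    IsBot ω (T p * F) (p + z) := by
  refine ⟨by rw [coeff_T_mul, add_sub_cancel_left]; exact h.1, fun z' hz' hne => ?_⟩
  rw [coeff_T_mul] at hz'
  have hlt := h.2 (z' - p) hz' (fun heq => hne (by rw [← heq, add_sub_cancel]))
  have : wt ω z' = wt ω p + wt ω (z' - p) := by rw [← wt_add, add_sub_cancel]
  rw [this, wt_add]
  linarith

/-- Adding a polynomial all of whose exponents are strictly heavier does not move the bottom. [folklore] -/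
theorem IsBot.add_of_forall_lt {ω : Fin 2 → ℝ} {F G : Laurent} {z : Fin 2 → ℤ} (h : IsBot ω F z)
    (hG : ∀ z', G.coeff z' ≠ 0 → wt ω z < wt ω z') : IsBot ω (F + G) z := by
  have hGz : G.coeff z = 0 := by
    by_contra hne
    exact lt_irrefl _ (hG z hne)
  refine ⟨by rw [AddMonoidAlgebra.coeff_add, Finsupp.add_apply, hGz, add_zero]; exact h.1, fun z' hz' hne => ?_⟩
  rw [AddMonoidAlgebra.coeff_add, Finsupp.add_apply] at hz'
  by_cases hF : F.coeff z' = 0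
  · rw [hF, zero_add] at hz'
    exact hG z' hz'
  · exact h.2 z' hF hne

/-- The bottom of a sum of two Laurent polynomials whose bottoms have different weights is the lighter bottom. [folklore] -/
theorem IsBot.add_of_lt {ω : Fin 2 → ℝ} {F G : Laurent} {z z' : Fin 2 → ℤ} (hF : IsBot ω F z) (hG : IsBot ω G z')
    (hlt : wt ω z < wt ω z') : IsBot ω (F + G) z :=
  hF.add_of_forall_lt fun y hy => lt_of_lt_of_le hlt (hG.le y hy)

/-- The bottom of a finite sum: if one summand has bottom `z` and all other summands only have strictly heavier
exponents, the sum has bottom `z`. [folklore] -/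
theorem isBot_sum_of_forall_lt {ω : Fin 2 → ℝ} {ι : Type*} (s : Finset ι) (G : ι → Laurent) (i₀ : ι) (hi₀ : i₀ ∈ s)
    {z : Fin 2 → ℤ} (h : IsBot ω (G i₀) z)
    (hG : ∀ i ∈ s, i ≠ i₀ → ∀ z', (G i).coeff z' ≠ 0 → wt ω z < wt ω z') : IsBot ω (∑ i ∈ s, G i) z := by
  classical
  rw [← Finset.add_sum_erase s G hi₀]
  refine h.add_of_forall_lt fun z' hz' => ?_
  rw [AddMonoidAlgebra.coeff_sum, Finsupp.finsetSum_apply] at hz'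
  obtain ⟨i, hi, hne⟩ := Finset.exists_ne_zero_of_sum_ne_zero hz'
  exact hG i (Finset.mem_of_mem_erase hi) (Finset.ne_of_mem_erase hi) z' hne

/-- **Bottom of a product** (no zero divisors needed: the product of the two bottom coefficients is the only
contribution at the sum of the bottoms, over the field `ℂ`). [folklore] -/
theorem IsBot.mul {ω : Fin 2 → ℝ} {F G : Laurent} {z z' : Fin 2 → ℤ} (hF : IsBot ω F z) (hG : IsBot ω G z') :
    IsBot ω (F * G) (z + z') := by
  classical
  -- coefficient formula for the product
  have hcoeff : ∀ y, (F * G).coeff y = ∑ a ∈ F.coeff.support, F.coeff a * G.coeff (y - a) := by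
    intro y
    rw [AddMonoidAlgebra.coeff_mul_apply_left, Finsupp.sum]
    exact Finset.sum_congr rfl fun a _ => by rw [neg_add_eq_sub]
  -- every nonzero exponent of the product weighs at least `wt z + wt z'`, with equality only at `z + z'`
  have hweight : ∀ y, (F * G).coeff y ≠ 0 → y ≠ z + z' → wt ω (z + z') < wt ω y := by
    intro y hy hne
    rw [hcoeff] at hy
    obtain ⟨a, ha, hprod⟩ := Finset.exists_ne_zero_of_sum_ne_zero hy
    have hFa : F.coeff a ≠ 0 := Finsupp.mem_support_iff.mp ha
    have hGb : G.coeff (y - a) ≠ 0 := right_ne_zero_of_mul hprod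
    have h1 := hF.le a hFa
    have h2 := hG.le (y - a) hGb
    have hy' : wt ω y = wt ω a + wt ω (y - a) := by rw [← wt_add, add_sub_cancel]
    rw [wt_add, hy']
    rcases lt_or_eq_of_le h1 with h1 | h1
    · linarith
    · rcases lt_or_eq_of_le h2 with h2 | h2
      · linarith
      · -- both equalities force `a = z` and `y - a = z'`, contradicting `y ≠ z + z'`
        exfalso
        have ha' : a = z := by
          by_contra hne'
          exact absurd h1 (ne_of_lt (hF.2 a hFa hne'))
        have hb' : y - a = z' := by
          by_contra hne'
          exact absurd h2 (ne_of_lt (hG.2 _ hGb hne'))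
        exact hne (by rw [← ha', ← hb']; abel)
  refine ⟨?_, hweight⟩
  -- the coefficient at `z + z'` is the product of the bottom coefficients
  rw [hcoeff, Finset.sum_eq_single z]
  · rw [add_sub_cancel_left]
    exact mul_ne_zero hF.1 hG.1
  · intro a ha hne
    have hFa : F.coeff a ≠ 0 := Finsupp.mem_support_iff.mp ha
    by_cases hGb : G.coeff (z + z' - a) = 0
    · rw [hGb, mul_zero]
    · exfalso
      have h1 := hF.2 a hFa hne
      have h2 := hG.le _ hGb
      have : wt ω (z + z' - a) = wt ω z + wt ω z' - wt ω a := by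
        rw [wt_sub, wt_add]
      linarith
  · intro hz
    exact absurd (Finsupp.notMem_support_iff.mp hz) hF.1

/-- Bottom of a finite product. [folklore] -/
theorem isBot_prod {ω : Fin 2 → ℝ} {ι : Type*} (s : Finset ι) (G : ι → Laurent) (b : ι → Fin 2 → ℤ)
    (h : ∀ i ∈ s, IsBot ω (G i) (b i)) : IsBot ω (∏ i ∈ s, G i) (∑ i ∈ s, b i) := by
  classical
  induction s using Finset.induction_on with
  | empty =>
    refine ⟨by simp [AddMonoidAlgebra.one_def], fun z' hz' hne => ?_⟩
    exfalso
    simp only [Finset.prod_empty, AddMonoidAlgebra.one_def, AddMonoidAlgebra.coeff_single,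
      Finsupp.single_apply] at hz'
    split_ifs at hz' with h0
    · exact hne (by rw [← h0, Finset.sum_empty])
    · exact hz' rfl
  | insert a s ha ih =>
    rw [Finset.prod_insert ha, Finset.sum_insert ha]
    exact (h a (Finset.mem_insert_self a s)).mul (ih fun i hi => h i (Finset.mem_insert_of_mem hi))

/-- From the bottom of a product and of one (nonzero-bottomed) factor, recover the bottom of the other factor (for a weight
injective on `ℤ²`). [folklore] -/
theorem isBot_of_mul_left {ω : Fin 2 → ℝ} (hω : Function.Injective (wt ω)) {F G : Laurent} {z y : Fin 2 → ℤ}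
    (hF : IsBot ω F z) (hFG : IsBot ω (F * G) y) : IsBot ω G (y - z) := by
  have hG0 : G ≠ 0 := by
    rintro rfl
    exact hFG.ne_zero (mul_zero F)
  obtain ⟨z', hz'⟩ := exists_isBot hω hG0
  have := (hF.mul hz').unique hFG
  rw [← this, add_sub_cancel_left]
  exact hz'

/-- **Polynomials**: `e` is the strict top of `p` for the weight `w` iff `expZ e` is the strict bottom of the Laurent
image of `p` for the weight `-w`. [folklore] -/
theorem isBot_toLaurent_iff (w : Fin 2 → ℝ) (p : MvPolynomial (Fin 2) ℂ) (e : Fin 2 →₀ ℕ) :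
    IsBot (-w) (toLaurent p) (expZ e) ↔ IsTop w p e := by
  constructor
  · rintro ⟨h1, h2⟩
    refine ⟨MvPolynomial.mem_support_iff.mpr (by rwa [coeff_toLaurent] at h1), fun e' he' hne => ?_⟩
    have := h2 (expZ e') (by rw [coeff_toLaurent]; exact MvPolynomial.mem_support_iff.mp he')
      (fun h => hne (expZ_injective h))
    rw [wt_neg_left, wt_neg_left, wt_expZ, wt_expZ] at this
    linarith
  · rintro ⟨h1, h2⟩
    refine ⟨by rw [coeff_toLaurent]; exact MvPolynomial.mem_support_iff.mp h1, fun z' hz' hne => ?_⟩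
    obtain ⟨e', rfl⟩ := exists_eq_expZ_of_coeff_toLaurent_ne_zero p z' hz'
    have := h2 e' (MvPolynomial.mem_support_iff.mpr (by rwa [coeff_toLaurent] at hz')) (fun h => hne (by rw [h]))
    rw [wt_neg_left, wt_neg_left, wt_expZ, wt_expZ]
    linarith

end Summit.ValiantsHypothesis.ValiantsHypothesis.Theorems.NewtonTauWeakK3

end
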